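import Mathlib
import Summits.Ventures.PercRepro2.Defs
import Summits.Ventures.PercRepro2.Harris
import Summits.Ventures.PercRepro2.Graph
import Summits.Ventures.PercRepro2.Events
import Summits.Ventures.PercRepro2.BHKEvents
import Summits.Ventures.PercRepro2.BHKAvoidWeighted
import Summits.Ventures.PercRepro2.PsiUniSure

/-!
# Harris weighted by an avoid event (PercRepro2, p2)

For a decreasing event `D` and increasing events `X, M` of the product measure put
`Γ(D; X, M) := P(D ∩ X ∩ M) + P(D)·P(X ∩ M) − P(D ∩ X)·P(M) − P(D ∩ M)·P(X)`
`= E[D₁·(X₁ − X₂)·(M₁ − M₂)]` over two independent copies — Harris with the decreasing weight `D`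
on one copy (`D = Ω` gives `2·Cov(X, M) ≥ 0`).  For `D = {s ↮ y}` and `X, M` up-set events of the
cluster `C_s` it is nonnegative (P2-G18-BERN.md §7f.2): with `q = P(D)`, `A = P(X ∩ D)`,
`B = P(M ∩ D)`, `AB = P(X ∩ M ∩ D)`, `x = P(X)`, `m = P(M)`, `xm = P(X ∩ M)`,
`q·Γ = (q·AB − A·B) + q²·(xm − x·m) + (q·x − A)·(q·m − B)`, and the three terms are the
avoid-conditioned same-cluster positive association (`bhk_same_cluster_events`), Harris, and the
product of two mixed-Harris gaps.  The (R2-1) inequality of the (PM⁺) line's crux is this `Γ`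
with `M` an up-set of `C_s ∪ C_y` instead — the open case.

* `weighted_harris_algebra` — the identity `q·Γ = …`;
* `weighted_harris_avoid` — **`Γ({s ↮ y}; X, M) ≥ 0` for up-set events `X, M` of `C_s`**;
* `weighted_harris_avoid_mem` — the instance `X = {u ∈ C_s}`, `M = {o ∈ C_s}`.
-/

namespace Summit.Ventures.PercRepro2

section WeightedHarris

variable {V : Type*} [Fintype V] [DecidableEq V] {E : Type*} [Fintype E] [DecidableEq E]
  {R : Type*} [CommRing R] [LinearOrder R] [IsStrictOrderedRing R]

omit [LinearOrder R] [IsStrictOrderedRing R] in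
/-- The identity behind the weighted Harris inequality. -/
lemma weighted_harris_algebra (q A B AB x m xm : R) :
    q * (AB + q * xm - A * m - B * x) =
      (q * AB - A * B) + q * q * (xm - x * m) + (q * x - A) * (q * m - B) := by
  ring

/-- **Harris weighted by the avoid event `{s ↮ y}`**: for up-sets `𝓤, 𝓥` of vertex sets,
`P(D ∩ X ∩ M) + P(D)·P(X ∩ M) ≥ P(D ∩ X)·P(M) + P(D ∩ M)·P(X)` with `D = {s ↮ y}`,
`X = {C_s ∈ 𝓤}`, `M = {C_s ∈ 𝓥}`. -/
theorem weighted_harris_avoid (p : E → R) (hp : IsProbVec p) (ends : E → Sym2 V) (s y : V)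
    {𝓤 𝓥 : Set (Set V)} (h𝓤 : IsUpperSet 𝓤) (h𝓥 : IsUpperSet 𝓥) :
    prob p (clusterInEvent ends s 𝓤 ∩ (connEvent ends s y)ᶜ) *
        prob p (clusterInEvent ends s 𝓥) +
      prob p (clusterInEvent ends s 𝓥 ∩ (connEvent ends s y)ᶜ) *
        prob p (clusterInEvent ends s 𝓤) ≤
    prob p (clusterInEvent ends s 𝓤 ∩ clusterInEvent ends s 𝓥 ∩ (connEvent ends s y)ᶜ) +
      prob p (connEvent ends s y)ᶜ *
        prob p (clusterInEvent ends s 𝓤 ∩ clusterInEvent ends s 𝓥) := by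
  have hX : IsUpperSet (clusterInEvent ends s 𝓤) := isUpperSet_clusterInEvent ends s h𝓤
  have hM : IsUpperSet (clusterInEvent ends s 𝓥) := isUpperSet_clusterInEvent ends s h𝓥
  have hD : IsLowerSet (connEvent ends s y)ᶜ := (isUpperSet_connEvent ends s y).compl
  -- the three nonnegative pieces
  have h1 := bhk_same_cluster_events p hp ends s y h𝓤 h𝓥
  have h2 := prob_mul_prob_le_prob_inter hp hX hM
  have h3 : prob p (clusterInEvent ends s 𝓤 ∩ (connEvent ends s y)ᶜ) ≤
      prob p (connEvent ends s y)ᶜ * prob p (clusterInEvent ends s 𝓤) := by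
    have h := prob_inter_le_prob_mul_prob_of_isLowerSet hp hD hX
    rw [Set.inter_comm] at h
    exact h
  have h4 : prob p (clusterInEvent ends s 𝓥 ∩ (connEvent ends s y)ᶜ) ≤
      prob p (connEvent ends s y)ᶜ * prob p (clusterInEvent ends s 𝓥) := by
    have h := prob_inter_le_prob_mul_prob_of_isLowerSet hp hD hM
    rw [Set.inter_comm] at h
    exact h
  have hq : 0 ≤ prob p (connEvent ends s y)ᶜ := prob_nonneg hp _
  rcases hq.lt_or_eq with hqpos | hq0
  · -- `q > 0`: divide the identity by `q`
    have key : 0 ≤ prob p (connEvent ends s y)ᶜ *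
        (prob p (clusterInEvent ends s 𝓤 ∩ clusterInEvent ends s 𝓥 ∩ (connEvent ends s y)ᶜ) +
          prob p (connEvent ends s y)ᶜ *
            prob p (clusterInEvent ends s 𝓤 ∩ clusterInEvent ends s 𝓥) -
          prob p (clusterInEvent ends s 𝓤 ∩ (connEvent ends s y)ᶜ) *
            prob p (clusterInEvent ends s 𝓥) -
          prob p (clusterInEvent ends s 𝓥 ∩ (connEvent ends s y)ᶜ) *
            prob p (clusterInEvent ends s 𝓤)) := by
      rw [weighted_harris_algebra]
      have e1 : 0 ≤ prob p (connEvent ends s y)ᶜ *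
          prob p (clusterInEvent ends s 𝓤 ∩ clusterInEvent ends s 𝓥 ∩ (connEvent ends s y)ᶜ) -
          prob p (clusterInEvent ends s 𝓤 ∩ (connEvent ends s y)ᶜ) *
            prob p (clusterInEvent ends s 𝓥 ∩ (connEvent ends s y)ᶜ) := by
        rw [mul_comm (prob p (connEvent ends s y)ᶜ)]; exact sub_nonneg.2 h1
      have e2 : 0 ≤ prob p (connEvent ends s y)ᶜ * prob p (connEvent ends s y)ᶜ *
          (prob p (clusterInEvent ends s 𝓤 ∩ clusterInEvent ends s 𝓥) -
            prob p (clusterInEvent ends s 𝓤) * prob p (clusterInEvent ends s 𝓥)) :=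
        mul_nonneg (mul_nonneg hq hq) (sub_nonneg.2 h2)
      have e3 : 0 ≤ (prob p (connEvent ends s y)ᶜ * prob p (clusterInEvent ends s 𝓤) -
          prob p (clusterInEvent ends s 𝓤 ∩ (connEvent ends s y)ᶜ)) *
          (prob p (connEvent ends s y)ᶜ * prob p (clusterInEvent ends s 𝓥) -
            prob p (clusterInEvent ends s 𝓥 ∩ (connEvent ends s y)ᶜ)) :=
        mul_nonneg (sub_nonneg.2 h3) (sub_nonneg.2 h4)
      linarith
    have := nonneg_of_mul_nonneg_right key hqpos
    linarith
  · -- `q = 0`: every mass intersected with `D` vanishes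
    have hq0' : prob p (connEvent ends s y)ᶜ = 0 := hq0.symm
    have z1 := prob_inter_eq_zero_of_right hp hq0' (clusterInEvent ends s 𝓤)
    have z2 := prob_inter_eq_zero_of_right hp hq0' (clusterInEvent ends s 𝓥)
    have z3 := prob_inter_eq_zero_of_right hp hq0'
      (clusterInEvent ends s 𝓤 ∩ clusterInEvent ends s 𝓥)
    rw [z1, z2, z3, hq0']
    simp

/-- The instance of the weighted Harris inequality with `X = {u ∈ C_s}` and `M = {o ∈ C_s}`: the
`h`-part `Γ({s ↮ y}; {s ↔ u}, {o ∈ C_s}) ≥ 0` of the crux (R2-1). -/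
theorem weighted_harris_avoid_mem (p : E → R) (hp : IsProbVec p) (ends : E → Sym2 V)
    (s y o u : V) :
    prob p (clusterInEvent ends s {W : Set V | u ∈ W} ∩ (connEvent ends s y)ᶜ) *
        prob p (clusterInEvent ends s {W : Set V | o ∈ W}) +
      prob p (clusterInEvent ends s {W : Set V | o ∈ W} ∩ (connEvent ends s y)ᶜ) *
        prob p (clusterInEvent ends s {W : Set V | u ∈ W}) ≤
    prob p (clusterInEvent ends s {W : Set V | u ∈ W} ∩ clusterInEvent ends s {W : Set V | o ∈ W} ∩
        (connEvent ends s y)ᶜ) +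
      prob p (connEvent ends s y)ᶜ *
        prob p (clusterInEvent ends s {W : Set V | u ∈ W} ∩
          clusterInEvent ends s {W : Set V | o ∈ W}) :=
  weighted_harris_avoid p hp ends s y (isUpperSet_memFamily u) (isUpperSet_memFamily o)

end WeightedHarris

end Summit.Ventures.PercRepro2
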